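import Literature.Probability.RandomPlanarGeometry.HexSAWPolygonSupermult
import Literature.Probability.RandomPlanarGeometry.HexSAWEndpointCarriers
import HarnessLib

/-!
# The honeycomb polygon numbers grow in every even step except `2`, `6`, `10`:
# `q_N(ℍ) ≤ q_{N+k}(ℍ)` for all `N ≥ 3` and all even `k ≥ 4`, `k ∉ {6, 10}`; `q_N(ℍ) > 0` for `N = 6` and every even `N ≥ 10`

Topic `Literature/Probability/RandomPlanarGeometry` (lane «pcv-sawmu», a-p4 g16; sequel of `HexSAWPolygonSupermult.lean` —
`HexBW.hexPolygonNumber_mul_le : q_N(ℍ)·q_M(ℍ) ≤ q_{N+M+2}(ℍ)` (`N, M ≥ 3`), `HexBW.hexPolygonNumber_le_add_four : q_N(ℍ) ≤ q_{N+4}(ℍ)`,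
`PolygonConcat.card_canonEnd : #canonEnd n = q_{n+1}(ℍ)` — and of `HexSAWPolygonBump.lean`, whose module doc records that the printed
Madras–Slade monotonicity `q_N ≤ q_{N+2}` (Theorem 3.2.3 (3.2.3), `ℤ^d`) is FALSE on `ℍ`: `q_10(ℍ) = 3 > 2 = q_12(ℍ)`).

## What is proved (namespace `Literature.Probability.RandomPlanarGeometry.SAW.HexBW`; `q_N(ℍ) = hexPolygonNumber N`)

* three explicit canonical traversals — the hexagon `hexagonWalk`, the two-brick bar `barWalk` and the three-brick triangle `triangleWalk`
  (`card_canonEnd_five_pos`, `_nine_pos`, `_eleven_pos`: `0 < #canonEnd 5, 9, 11`) — whence `q_6(ℍ), q_10(ℍ), q_12(ℍ) ≥ 1`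
  (`hexPolygonNumber_six_pos`, `_ten_pos`, `_twelve_pos`);
* **`hexPolygonNumber_pos_of_even_of_ten_le : 10 ≤ N → Even N → 0 < q_N(ℍ)`** (bar/triangle + `q_N ≤ q_{N+4}`; the tree's
  `HexSAWPolygonMadrasBootstrap.hexPolygonNumber_pos_of_even` needs `N ≥ 26`);
* `hexPolygonNumber_le_add_of_pos : 3 ≤ N → 3 ≤ M → 0 < q_M → q_N ≤ q_{N+M+2}` (supermultiplicativity with a positive factor),
  `hexPolygonNumber_le_add_eight` (`M = 6`) (the iterated bump `q_N ≤ q_{N+4j}` is the tree's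
  `HexSAWPolygonJoinCount.HexBW.hexPolygonNumber_le_add_four_mul`, not restated);
* **`hexPolygonNumber_le_add_even : 3 ≤ N → Even k → 4 ≤ k → k ≠ 6 → k ≠ 10 → q_N(ℍ) ≤ q_{N+k}(ℍ)`** and the two-length form
  `hexPolygonNumber_mono_of_twelve_le : 3 ≤ N → N + 12 ≤ N' → Even (N' − N) → q_N(ℍ) ≤ q_{N'}(ℍ)`;
* `eventually_hexPolygonNumber_lt_add_two : ∀ᶠ m, q_{2m+2}(ℍ) < q_{2m+4}(ℍ)` (the step `2` holds EVENTUALLY, from the tree's ratio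
  theorem `HV.hexPolygonNumberRatioTwo : q_{2m+4}/q_{2m+2} → 2 + √2`; ineffective).

## What is NOT proved (data, door note)

Printed counts (I. Jensen; Guttmann–Jensen, LNP 775 Table 16.3; re-enumerated twice in the lane up to `N = 38`): `q_6 = 1, q_8 = 0, q_10 = 3,
q_12 = 2, q_14 = 12, q_16 = 18, q_18 = 65, q_20 = 138, …, q_40 = 5783700, q_42 = 17564727`; so the step `2` fails at `N = 6` and `N = 10`
and holds for every even `12 ≤ N ≤ 40`, while the steps `6` and `10` hold for every `N` with `N + k ≤ 42` — DATA, not proved here.  A uniform proof of `q_N ≤ q_{N+2}` (`N ≥ 12` even), `q_N ≤ q_{N+6}` or `q_N ≤ q_{N+10}` needs a surgery outside the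
right-half-plane brick join of `HexSAWPolygonConcatenation.glue` (a glue-form detour closes up, with the removed bond, into a polygon of
length `m + 5`, so the length shift `m + 3` is `≡ 0 (mod 4)` or `≥ 14`: there are no `4`- or `8`-gons on `ℍ`) — OPEN here.

Sources: N. Madras, G. Slade, *The Self-Avoiding Walk* (1993), Theorem 3.2.3 (3.2.2)–(3.2.3) p. 64 (`ℤ^d`) [MadrasSlade1993];
S. G. Whittington, in LNP 775 (2009), §2.2–2.3 (2.3)–(2.6) pp. 25–26 (hypercubic) [Whittington2009LatticePolygons]; I. Jensen,
J. Phys.: Conf. Ser. 42 (2006) 163 (the honeycomb `p_n`) [Jensen2006HoneycombPolygons].  Status in print: a monotonicity lemma for the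
honeycomb polygon numbers is not located (corpus fts + vec, galaxy; 2026-08-25); NEW IN WRITING (modest): the bookkeeping below.
-/

noncomputable section

open Finset Function Filter Topology Literature.Probability.LatticeModels Literature.Probability.Percolation SimpleGraph

namespace Literature.Probability.RandomPlanarGeometry.SAW

namespace HexBW

namespace PolygonConcat

/-! ### Explicit sites and the three small polygons -/

/-! Sites are written `pt a b = ![a, b]` with `pt_inj`, `adj_pt_iff` from `HexSAWEndpointCarriers.lean`. -/

/-- `pt a b` is lexicographically `≥ 0` when `a > 0`, or `a = 0 ≤ b`. [cite: MadrasSlade1993, §3.2 (proof of Theorem 3.2.3: `Q[N]`)] -/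
theorem lexNonneg_pt {a b : ℤ} (h : 0 < a ∨ (a = 0 ∧ 0 ≤ b)) : LexNonneg (pt a b) := by
  unfold LexNonneg; simpa using h

/-- **The hexagon**, canonically traversed: `(0,0) → (0,1) → (1,1) → (2,1) → (2,0) → (1,0)` (the brick `[0,2]×[0,1]` minus its root bond).
[cite: Jensen2006HoneycombPolygons, §2 (p_6 = 1)] -/
def hexagonWalk : ℕ → Site 2
  | 0 => pt 0 0
  | 1 => pt 0 1
  | 2 => pt 1 1
  | 3 => pt 2 1
  | 4 => pt 2 0
  | _ => pt 1 0

/-- **The two-brick bar**, canonically traversed (bricks `[0,2]×[0,1]`, `[2,4]×[0,1]`; a `10`-gon).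
[cite: Jensen2006HoneycombPolygons, §2 (p_10 = 3)] -/
def barWalk : ℕ → Site 2
  | 0 => pt 0 0
  | 1 => pt 0 1
  | 2 => pt 1 1
  | 3 => pt 2 1
  | 4 => pt 3 1
  | 5 => pt 4 1
  | 6 => pt 4 0
  | 7 => pt 3 0
  | 8 => pt 2 0
  | _ => pt 1 0

/-- **The three-brick triangle**, canonically traversed (bricks `[0,2]×[0,1]`, `[2,4]×[0,1]`, `[1,3]×[1,2]`; a `12`-gon).
[cite: Jensen2006HoneycombPolygons, §2 (p_12 = 2)] -/
def triangleWalk : ℕ → Site 2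
  | 0 => pt 0 0
  | 1 => pt 0 1
  | 2 => pt 1 1
  | 3 => pt 1 2
  | 4 => pt 2 2
  | 5 => pt 3 2
  | 6 => pt 3 1
  | 7 => pt 4 1
  | 8 => pt 4 0
  | 9 => pt 3 0
  | 10 => pt 2 0
  | _ => pt 1 0

/-- Frozen tail of the hexagon. [cite: Jensen2006HoneycombPolygons, §2] -/
theorem hexagonWalk_of_ge {i : ℕ} (hi : 5 ≤ i) : hexagonWalk i = pt 1 0 := by
  obtain ⟨j, rfl⟩ : ∃ j, i = j + 5 := ⟨i - 5, by omega⟩; simp [hexagonWalk]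

/-- Frozen tail of the bar. [cite: Jensen2006HoneycombPolygons, §2] -/
theorem barWalk_of_ge {i : ℕ} (hi : 9 ≤ i) : barWalk i = pt 1 0 := by
  obtain ⟨j, rfl⟩ : ∃ j, i = j + 9 := ⟨i - 9, by omega⟩; simp [barWalk]

/-- Frozen tail of the triangle. [cite: Jensen2006HoneycombPolygons, §2] -/
theorem triangleWalk_of_ge {i : ℕ} (hi : 11 ≤ i) : triangleWalk i = pt 1 0 := by
  obtain ⟨j, rfl⟩ : ∃ j, i = j + 11 := ⟨i - 11, by omega⟩; simp [triangleWalk]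

/-- **The hexagon is a canonical rooted `6`-gon**, counted: `0 < #(canonEnd 5)` (witness `hexagonWalk`; membership is unfolded by
`mem_canonEnd`/`mem_endAt_iff` BEFORE any term is matched against it — matching a term against the folded `Finset` membership makes the
elaborator evaluate `canonEnd 5`). [cite: MadrasSlade1993, §3.2 (proof of Theorem 3.2.3: `Q[N]` has `q_N` members)]
[cite: Jensen2006HoneycombPolygons, §2 (p_6)] -/
theorem card_canonEnd_five_pos : 0 < #(canonEnd 5) := by
  rw [Finset.card_pos]
  refine ⟨hexagonWalk, ?_⟩
  rw [mem_canonEnd, mem_endAt_iff]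
  refine ⟨⟨⟨?_, ?_, ?_, ?_⟩, ?_⟩, ?_⟩
  · -- start `(0,0)`
    show pt 0 0 = 0
    funext j; fin_cases j <;> rfl
  · -- frozen after time `5`
    intro i hi; rw [hexagonWalk_of_ge hi, hexagonWalk_of_ge le_rfl]
  · -- brick-wall steps
    intro i hi
    interval_cases i <;> exact adj_pt_iff.2 (by omega)
  · -- self-avoiding
    intro i hi j hj h
    simp only [Set.mem_setOf_eq] at hi hj
    interval_cases i <;> interval_cases j <;> simp only [hexagonWalk] at h <;>
      first | rfl | (obtain ⟨h1, h2⟩ := pt_inj.1 h; omega)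
  · -- end `e₀ = (1,0)`
    show pt 1 0 = _
    funext j; fin_cases j <;> simp [pt]
  · -- canonical: all sites lexicographically `≥ 0`
    intro i hi
    interval_cases i <;> exact lexNonneg_pt (by omega)

/-- **The two-brick bar is a canonical rooted `10`-gon**, counted: `0 < #(canonEnd 9)` (witness `barWalk`; membership is unfolded by
`mem_canonEnd`/`mem_endAt_iff` BEFORE any term is matched against it — matching a term against the folded `Finset` membership makes the
elaborator evaluate `canonEnd 9`). [cite: MadrasSlade1993, §3.2 (proof of Theorem 3.2.3: `Q[N]` has `q_N` members)]
[cite: Jensen2006HoneycombPolygons, §2 (p_10)] -/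
theorem card_canonEnd_nine_pos : 0 < #(canonEnd 9) := by
  rw [Finset.card_pos]
  refine ⟨barWalk, ?_⟩
  rw [mem_canonEnd, mem_endAt_iff]
  refine ⟨⟨⟨?_, ?_, ?_, ?_⟩, ?_⟩, ?_⟩
  · -- start `(0,0)`
    show pt 0 0 = 0
    funext j; fin_cases j <;> rfl
  · -- frozen after time `9`
    intro i hi; rw [barWalk_of_ge hi, barWalk_of_ge le_rfl]
  · -- brick-wall steps
    intro i hi
    interval_cases i <;> exact adj_pt_iff.2 (by omega)
  · -- self-avoiding
    intro i hi j hj h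
    simp only [Set.mem_setOf_eq] at hi hj
    interval_cases i <;> interval_cases j <;> simp only [barWalk] at h <;>
      first | rfl | (obtain ⟨h1, h2⟩ := pt_inj.1 h; omega)
  · -- end `e₀ = (1,0)`
    show pt 1 0 = _
    funext j; fin_cases j <;> simp [pt]
  · -- canonical: all sites lexicographically `≥ 0`
    intro i hi
    interval_cases i <;> exact lexNonneg_pt (by omega)

/-- **The three-brick triangle is a canonical rooted `12`-gon**, counted: `0 < #(canonEnd 11)` (witness `triangleWalk`; membership is unfolded by
`mem_canonEnd`/`mem_endAt_iff` BEFORE any term is matched against it — matching a term against the folded `Finset` membership makes the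
elaborator evaluate `canonEnd 11`). [cite: MadrasSlade1993, §3.2 (proof of Theorem 3.2.3: `Q[N]` has `q_N` members)]
[cite: Jensen2006HoneycombPolygons, §2 (p_12)] -/
theorem card_canonEnd_eleven_pos : 0 < #(canonEnd 11) := by
  rw [Finset.card_pos]
  refine ⟨triangleWalk, ?_⟩
  rw [mem_canonEnd, mem_endAt_iff]
  refine ⟨⟨⟨?_, ?_, ?_, ?_⟩, ?_⟩, ?_⟩
  · -- start `(0,0)`
    show pt 0 0 = 0
    funext j; fin_cases j <;> rfl
  · -- frozen after time `11`
    intro i hi; rw [triangleWalk_of_ge hi, triangleWalk_of_ge le_rfl]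
  · -- brick-wall steps
    intro i hi
    interval_cases i <;> exact adj_pt_iff.2 (by omega)
  · -- self-avoiding
    intro i hi j hj h
    simp only [Set.mem_setOf_eq] at hi hj
    interval_cases i <;> interval_cases j <;> simp only [triangleWalk] at h <;>
      first | rfl | (obtain ⟨h1, h2⟩ := pt_inj.1 h; omega)
  · -- end `e₀ = (1,0)`
    show pt 1 0 = _
    funext j; fin_cases j <;> simp [pt]
  · -- canonical: all sites lexicographically `≥ 0`
    intro i hi
    interval_cases i <;> exact lexNonneg_pt (by omega)

end PolygonConcat

open PolygonConcat

variable {N M N' k : ℕ}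

/-! ### Positivity of the small polygon numbers -/

/-- `q_6(ℍ) ≥ 1` (the hexagon). [cite: Jensen2006HoneycombPolygons, §2 (p_6 = 1)] [cite: MadrasSlade1993, Definition 3.2.2 p. 63] -/
theorem hexPolygonNumber_six_pos : 0 < hexPolygonNumber 6 := by
  -- `#canonEnd 5 = q_{5+1}`; the numeral is normalised syntactically (`Nat.reduceAdd`), no unfolding of `hexPolygonNumber`
  have h : #(canonEnd 5) = hexPolygonNumber (5 + 1) := card_canonEnd (n := 5) (by norm_num)
  simp only [Nat.reduceAdd] at h
  rw [← h]
  exact card_canonEnd_five_pos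

/-- `q_10(ℍ) ≥ 1` (the two-brick bar). [cite: Jensen2006HoneycombPolygons, §2 (p_10 = 3)] [cite: MadrasSlade1993, Definition 3.2.2 p. 63] -/
theorem hexPolygonNumber_ten_pos : 0 < hexPolygonNumber 10 := by
  -- `#canonEnd 9 = q_{9+1}`; the numeral is normalised syntactically (`Nat.reduceAdd`), no unfolding of `hexPolygonNumber`
  have h : #(canonEnd 9) = hexPolygonNumber (9 + 1) := card_canonEnd (n := 9) (by norm_num)
  simp only [Nat.reduceAdd] at h
  rw [← h]
  exact card_canonEnd_nine_pos

/-- `q_12(ℍ) ≥ 1` (the three-brick triangle). [cite: Jensen2006HoneycombPolygons, §2 (p_12 = 2)] [cite: MadrasSlade1993, Definition 3.2.2 p. 63] -/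
theorem hexPolygonNumber_twelve_pos : 0 < hexPolygonNumber 12 := by
  -- `#canonEnd 11 = q_{11+1}`; the numeral is normalised syntactically (`Nat.reduceAdd`), no unfolding of `hexPolygonNumber`
  have h : #(canonEnd 11) = hexPolygonNumber (11 + 1) := card_canonEnd (n := 11) (by norm_num)
  simp only [Nat.reduceAdd] at h
  rw [← h]
  exact card_canonEnd_eleven_pos

/-- **`q_N(ℍ) > 0` for every even `N ≥ 10`** (from `q_10, q_12 ≥ 1` by `q_N ≤ q_{N+4}`; the tree's
`hexPolygonNumber_pos_of_even` has the threshold `26`). [cite: MadrasSlade1993, Theorem 3.2.3 (3.2.3) p. 64] [cite: Jensen2006HoneycombPolygons, §2] -/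
theorem hexPolygonNumber_pos_of_even_of_ten_le (hN : 10 ≤ N) (hNe : Even N) : 0 < hexPolygonNumber N := by
  -- `P j : 0 < q_{10+4j} ∧ 0 < q_{12+4j}`
  have key : ∀ j : ℕ, 0 < hexPolygonNumber (10 + 4 * j) ∧ 0 < hexPolygonNumber (12 + 4 * j) := by
    intro j
    induction j with
    | zero => exact ⟨hexPolygonNumber_ten_pos, hexPolygonNumber_twelve_pos⟩
    | succ j ih =>
      refine ⟨lt_of_lt_of_le ih.1 ?_, lt_of_lt_of_le ih.2 ?_⟩
      · rw [show 10 + 4 * (j + 1) = 10 + 4 * j + 4 by ring]; exact hexPolygonNumber_le_add_four (by omega)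
      · rw [show 12 + 4 * (j + 1) = 12 + 4 * j + 4 by ring]; exact hexPolygonNumber_le_add_four (by omega)
  obtain ⟨r, hr⟩ := hNe
  rcases Nat.even_or_odd r with ⟨s, hs⟩ | ⟨s, hs⟩
  · -- `N = 4s`, `s ≥ 3`: `N = 12 + 4(s-3)`
    have h := (key (s - 3)).2
    rwa [show 12 + 4 * (s - 3) = N by omega] at h
  · -- `N = 4s+2`, `s ≥ 2`: `N = 10 + 4(s-2)`
    have h := (key (s - 2)).1
    rwa [show 10 + 4 * (s - 2) = N by omega] at h

/-! ### Monotonicity in even steps other than `2`, `6`, `10` -/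

/-- **Supermultiplicativity with a positive factor**: `q_N(ℍ) ≤ q_{N+M+2}(ℍ)` whenever `q_M(ℍ) > 0` (`N, M ≥ 3`).
[cite: MadrasSlade1993, Theorem 3.2.3 (3.2.2) p. 64] [cite: Whittington2009LatticePolygons, (2.3) p. 25 (hypercubic)] -/
theorem hexPolygonNumber_le_add_of_pos (hN : 3 ≤ N) (hM : 3 ≤ M) (hpos : 0 < hexPolygonNumber M) :
    hexPolygonNumber N ≤ hexPolygonNumber (N + M + 2) :=
  le_trans (Nat.le_mul_of_pos_right _ hpos) (hexPolygonNumber_mul_le hN hM)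

/-- `q_N(ℍ) ≤ q_{N+8}(ℍ)` for `N ≥ 3` (join with the hexagon). [cite: MadrasSlade1993, Theorem 3.2.3 (3.2.2)–(3.2.3) p. 64] -/
theorem hexPolygonNumber_le_add_eight (hN : 3 ≤ N) : hexPolygonNumber N ≤ hexPolygonNumber (N + 8) := by
  rw [show N + 8 = N + 6 + 2 by ring]
  exact hexPolygonNumber_le_add_of_pos hN (by norm_num) hexPolygonNumber_six_pos

/-- **The honeycomb polygon numbers grow in every even step except `2`, `6`, `10`**: for `N ≥ 3` and even `k ≥ 4` with
`k ≠ 6`, `k ≠ 10`, `q_N(ℍ) ≤ q_{N+k}(ℍ)` (`k = 4j`: brick bumps; `k = 8`: join with the hexagon; `k ≥ 12`: join with an even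
polygon of length `k − 2 ≥ 10`, which exists).  The step `2` is false at `N = 6, 10` (printed table) and open uniformly for
`N ≥ 12`; the steps `6`, `10` are open. [cite: MadrasSlade1993, Theorem 3.2.3 (3.2.2)–(3.2.3) p. 64 (ℤ^d: q_N ≤ q_{N+2})]
[cite: Jensen2006HoneycombPolygons, §2 (the honeycomb polygon numbers)] -/
theorem hexPolygonNumber_le_add_even (hN : 3 ≤ N) (hk : Even k) (h4 : 4 ≤ k) (h6 : k ≠ 6) (h10 : k ≠ 10) :
    hexPolygonNumber N ≤ hexPolygonNumber (N + k) := by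
  by_cases hk4 : k = 4
  · subst hk4; exact hexPolygonNumber_le_add_four hN
  by_cases hk8 : k = 8
  · subst hk8; exact hexPolygonNumber_le_add_eight hN
  -- `k ≥ 12`: `k - 2 ≥ 10` is even and `q_{k-2} > 0`
  have hk12 : 12 ≤ k := by obtain ⟨r, hr⟩ := hk; omega
  have hpos : 0 < hexPolygonNumber (k - 2) :=
    hexPolygonNumber_pos_of_even_of_ten_le (by omega) (by obtain ⟨r, hr⟩ := hk; exact ⟨r - 1, by omega⟩)
  have h := hexPolygonNumber_le_add_of_pos hN (show 3 ≤ k - 2 by omega) hpos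
  rwa [show N + (k - 2) + 2 = N + k by omega] at h

/-- Two-length form: `q_N(ℍ) ≤ q_{N'}(ℍ)` whenever `N ≥ 3`, `N' ≥ N + 12` and `N' − N` is even.
[cite: MadrasSlade1993, Theorem 3.2.3 (3.2.2)–(3.2.3) p. 64] -/
theorem hexPolygonNumber_mono_of_twelve_le (hN : 3 ≤ N) (hNN' : N + 12 ≤ N') (he : Even (N' - N)) :
    hexPolygonNumber N ≤ hexPolygonNumber N' := by
  have h := hexPolygonNumber_le_add_even hN he (by omega) (by omega) (by omega)
  rwa [show N + (N' - N) = N' by omega] at h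

/-! ### The step `2` holds eventually -/

/-- **Eventually `q_{2m+2}(ℍ) < q_{2m+4}(ℍ)`**: the step `2` of Madras–Slade (3.2.3) holds on `ℍ` for all large even lengths, because
`q_{2m+4}(ℍ)/q_{2m+2}(ℍ) → 2 + √2 > 1` (the tree's `HV.hexPolygonNumberRatioTwo`; no threshold is extracted — the printed table says the
last failure is `N = 10`). [cite: MadrasSlade1993, Theorem 7.3.4 (c) p. 248 and Theorem 3.2.3 (3.2.3) p. 64] [cite: Jensen2006HoneycombPolygons, §2] -/
theorem eventually_hexPolygonNumber_lt_add_two :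
    ∀ᶠ m : ℕ in atTop, hexPolygonNumber (2 * m + 2) < hexPolygonNumber (2 * m + 4) := by
  have hlim := HV.hexPolygonNumberRatioTwo
  have h1 : (1 : ℝ) < 2 + Real.sqrt 2 := by
    have := Real.sqrt_nonneg 2; linarith
  have hev : ∀ᶠ m : ℕ in atTop, (1 : ℝ) < (hexPolygonNumber (2 * m + 4) : ℝ) / hexPolygonNumber (2 * m + 2) :=
    hlim.eventually (lt_mem_nhds h1)
  filter_upwards [hev] with m hm
  have hq0 : (hexPolygonNumber (2 * m + 2) : ℝ) ≠ 0 := by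
    intro h0; rw [h0, div_zero] at hm; linarith
  have hqpos : (0 : ℝ) < hexPolygonNumber (2 * m + 2) := lt_of_le_of_ne (Nat.cast_nonneg _) (Ne.symm hq0)
  rw [lt_div_iff₀ hqpos, one_mul] at hm
  exact_mod_cast hm

end HexBW

end Literature.Probability.RandomPlanarGeometry.SAW

end
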